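import Summits.Ventures.Crystal3D.StickySpheres.RadiusOne
import Literature.Geometry.DiscreteGeometry.KissingNodeTypes
import HarnessLib

/-!
# Two local rules of contact graphs of unit-ball packings in `ℝ³`:
# an edge lies in at most five triangles, a triangle in at most two tetrahedra

Venture `Crystal3D` (cell `pub-crystal3d`, seat p2), companion of `StickySpheres/ContactGraph.lean` (p3) and of
`Literature/Barriers/AtomisticToContinuum/StickySphereClusters.lean` (`no_five_pairwise_dist_two`: no `K₅`).

HONEST FRAMING. These are the elementary geometric facts behind two of the three pruning filters an
Arkus–Manoharan–Brenner-style enumeration applies to candidate adjacency matrices before any distance equation is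
solved (engine-1's `pair5` and `triple2`; the third, `K5`, is `no_five_pairwise_dist_two`). They are proved here so
that every graph the cell's engines refute by these filters is refuted by a theorem of the tree (referee protocol
S3). Nothing here is an enumeration result or a crystallization statement.

* `no_six_common_neighbours` (radius-`1` / contact-`2` form, the Literature convention): two touching balls have at
  most five common touching neighbours. Proof: the common neighbours lie on the circle of radius `√3` about the
  midpoint; two of them at distance `≥ 2` are seen from the axis under an angle with cosine `≤ 1/3`, hence
  `> π/3`; six such angles around the circle would exceed `2π` (the tangent-plane polar coordinates and the sorting
  are those of `KissingNodeDegree.lean`, Hales 2012 Lemma 7, whose public lemmas are reused).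
* `apices_le_two`: at most two balls touch all three balls of a touching triple (the two mirror positions over the
  triangle). Proof: linear algebra in `ℝ³` — the differences of apex vectors are orthogonal to the plane of the
  triangle, hence parallel, and the norm constraint leaves `t ∈ {0, 1}`.
* Corollaries in the cell's diameter-`1` vocabulary (`IsUnitPacking`, `contactNeighbors`):
  `card_common_contactNeighbors_le_five`, `card_common_contactNeighbors_three_le_two`.
-/

noncomputable section

open Real Finset RealInnerProductSpace

namespace Summit.Ventures.Crystal3D

open Literature.Geometry.DiscreteGeometry (exists_orthonormalBasis_third_eq inner_eq_two_of_dist_eq_two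
  inner_eq_sum_three eq_of_inner_basis_eq eq_sqrt_three_mul_cos_sin_arg mul_add_mul_eq_three_mul_cos
  arccos_third_le_of_cos_le pi_div_three_lt_arccos_third)

/-! ### 1. Six gaps around a circle -/

/-- **No six gaps.** Six nonnegative angles summing to `2π`, each with cosine `≤ 1/3`, do not exist: each is
`≥ arccos (1/3) > π/3`. [folklore] -/
theorem six_gaps_false (g : Fin 6 → ℝ) (h0 : ∀ k, 0 ≤ g k)
    (hsum : g 0 + g 1 + g 2 + g 3 + g 4 + g 5 = 2 * π) (hc : ∀ k, cos (g k) ≤ 1 / 3) : False := by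
  have hlow : ∀ k, arccos (1 / 3) ≤ g k := fun k => arccos_third_le_of_cos_le (h0 k) (hc k)
  have h3 := pi_div_three_lt_arccos_third
  have := hlow 0; have := hlow 1; have := hlow 2; have := hlow 3; have := hlow 4; have := hlow 5
  linarith

/-- **No six sorted directions.** Six angles `−π < t₀ < ⋯ < t₅ ≤ π` whose pairwise differences all have cosine
`≤ 1/3` do not exist. [folklore] -/
theorem six_sorted_angles_false (t : Fin 6 → ℝ) (hmono : StrictMono t) (hlo : -π < t 0) (hhi : t 5 ≤ π)
    (hC : ∀ i j, i ≠ j → cos (t i - t j) ≤ 1 / 3) : False := by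
  have h01 : t 0 < t 1 := hmono (by decide)
  have h12 : t 1 < t 2 := hmono (by decide)
  have h23 : t 2 < t 3 := hmono (by decide)
  have h34 : t 3 < t 4 := hmono (by decide)
  have h45 : t 4 < t 5 := hmono (by decide)
  have hw : cos (2 * π - (t 5 - t 0)) = cos (t 5 - t 0) := cos_two_pi_sub _
  refine six_gaps_false ![t 1 - t 0, t 2 - t 1, t 3 - t 2, t 4 - t 3, t 5 - t 4, 2 * π - (t 5 - t 0)] ?_ ?_ ?_
  · intro k
    fin_cases k <;> simp <;> linarith
  · simp only [Matrix.cons_val_zero, Matrix.cons_val_one, Matrix.cons_val]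
    ring
  · intro k
    fin_cases k
    · simpa using hC 1 0 (by decide)
    · simpa using hC 2 1 (by decide)
    · simpa using hC 3 2 (by decide)
    · simpa using hC 4 3 (by decide)
    · simpa using hC 5 4 (by decide)
    · simpa [hw] using hC 5 0 (by decide)

/-! ### 2. At most five common neighbours of a touching pair (radius-1 balls, contact = distance 2) -/

/-- **No six common neighbours (centred form).** There are no six distinct points of `S²(2)` at distance `2`
from a point `v ∈ S²(2)` and pairwise at distance `≥ 2`. (The balls centred at `0` and `v` touch; the six points
would be centres of balls touching both.) [folklore] -/
theorem no_six_common_neighbours {v : EuclideanSpace ℝ (Fin 3)} (hv : ‖v‖ = 2) (u : Fin 6 → EuclideanSpace ℝ (Fin 3)) (hinj : Function.Injective u)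
    (hn : ∀ k, ‖u k‖ = 2) (hd : ∀ k, dist (u k) v = 2) (hsep : ∀ i j, i ≠ j → 2 ≤ dist (u i) (u j)) :
    False := by
  obtain ⟨b, hb⟩ := exists_orthonormalBasis_third_eq hv
  set X : Fin 6 → ℝ := fun k => ⟪b 0, u k⟫ with hXdef
  set Y : Fin 6 → ℝ := fun k => ⟪b 1, u k⟫ with hYdef
  have hZ : ∀ k, ⟪b 2, u k⟫ = 1 := by
    intro k
    rw [hb, real_inner_smul_left, real_inner_comm, inner_eq_two_of_dist_eq_two (hn k) hv (hd k)]
    norm_num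
  have hXY : ∀ k, X k ^ 2 + Y k ^ 2 = 3 := by
    intro k
    have h4 : ⟪u k, u k⟫ = 4 := by rw [real_inner_self_eq_norm_sq, hn k]; norm_num
    rw [inner_eq_sum_three b, hZ k] at h4
    simp only [hXdef, hYdef]
    nlinarith [h4]
  set θ : Fin 6 → ℝ := fun k => Complex.arg ⟨X k, Y k⟩ with hθdef
  have hdist : ∀ i j, dist (u i) (u j) ^ 2 = 6 - 6 * cos (θ i - θ j) := by
    intro i j
    have hc := mul_add_mul_eq_three_mul_cos (hXY i) (hXY j)
    rw [dist_eq_norm, norm_sub_sq_real, hn i, hn j, inner_eq_sum_three b, hZ i, hZ j]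
    simp only [hθdef]
    linarith [hc]
  have hθinj : Function.Injective θ := by
    intro i j hij
    apply hinj
    obtain ⟨hXi, hYi⟩ := eq_sqrt_three_mul_cos_sin_arg (hXY i)
    obtain ⟨hXj, hYj⟩ := eq_sqrt_three_mul_cos_sin_arg (hXY j)
    have hij' : Complex.arg ⟨X i, Y i⟩ = Complex.arg ⟨X j, Y j⟩ := hij
    refine eq_of_inner_basis_eq b fun m => ?_
    fin_cases m
    · show X i = X j
      rw [hXi, hXj, hij']
    · show Y i = Y j
      rw [hYi, hYj, hij']
    · simp only [Fin.reduceFinMk, hZ]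
  have hC : ∀ i j, i ≠ j → cos (θ i - θ j) ≤ 1 / 3 := by
    intro i j hij
    have hsq := hdist i j
    have h2 := hsep i j hij
    have h4 : (4 : ℝ) ≤ dist (u i) (u j) ^ 2 := by nlinarith
    linarith
  -- sort the six angles
  have hAcard : (Finset.univ.image θ).card = 6 := by
    rw [Finset.card_image_of_injective _ hθinj, Finset.card_univ, Fintype.card_fin]
  let e := (Finset.univ.image θ).orderEmbOfFin hAcard
  have hmem : ∀ k, ∃ i, θ i = e k := by
    intro k
    have := (Finset.univ.image θ).orderEmbOfFin_mem hAcard k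
    rw [Finset.mem_image] at this
    obtain ⟨i, -, hi⟩ := this
    exact ⟨i, hi⟩
  choose π' hπ' using hmem
  refine six_sorted_angles_false (fun k => e k) e.strictMono ?_ ?_ ?_
  · show -π < e 0
    rw [← hπ' 0]; exact Complex.neg_pi_lt_arg _
  · show e 5 ≤ π
    rw [← hπ' 5]; exact Complex.arg_le_pi _
  · intro i j hij
    have hne : π' i ≠ π' j := by
      intro h; apply hij; apply e.injective; rw [← hπ' i, ← hπ' j, h]
    rw [← hπ' i, ← hπ' j]
    exact hC _ _ hne

/-- **An edge of the contact graph lies in at most five triangles (radius-1 form).** If `dist a c = 2` and the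
points `q k` (`k : Fin 6`, distinct) are all at distance `2` from both `a` and `c` and pairwise at distance `≥ 2`,
contradiction. [folklore] -/
theorem no_six_common_neighbours' {a c : EuclideanSpace ℝ (Fin 3)} (hac : dist a c = 2) (q : Fin 6 → EuclideanSpace ℝ (Fin 3)) (hinj : Function.Injective q)
    (ha : ∀ k, dist (q k) a = 2) (hc : ∀ k, dist (q k) c = 2) (hsep : ∀ i j, i ≠ j → 2 ≤ dist (q i) (q j)) :
    False := by
  refine no_six_common_neighbours (v := c - a) (by rw [← dist_eq_norm, dist_comm, hac]) (fun k => q k - a)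
    (fun i j h => hinj (sub_left_injective h)) (fun k => by rw [← dist_eq_norm]; exact ha k)
    (fun k => by rw [dist_eq_norm, sub_sub_sub_cancel_right, ← dist_eq_norm]; exact hc k)
    (fun i j hij => by rw [dist_eq_norm, sub_sub_sub_cancel_right, ← dist_eq_norm]; exact hsep i j hij)

/-! ### 3. At most two apices over a touching triple -/

/-- **Inner products of an apex vector.** If `a, b` are at distance `2` and `p` is at distance `2` from both,
then `⟪p − a, b − a⟫ = 2`. [folklore] -/
theorem inner_apex_eq_two {a b p : EuclideanSpace ℝ (Fin 3)} (hab : dist a b = 2) (hpa : dist p a = 2) (hpb : dist p b = 2) :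
    ⟪p - a, b - a⟫ = 2 := by
  have h1 : ‖p - a‖ = 2 := by rw [← dist_eq_norm]; exact hpa
  have h2 : ‖b - a‖ = 2 := by rw [← dist_eq_norm, dist_comm]; exact hab
  have h3 : ‖(p - a) - (b - a)‖ = 2 := by rw [sub_sub_sub_cancel_right, ← dist_eq_norm]; exact hpb
  have e := norm_sub_sq_real (p - a) (b - a)
  rw [h1, h2, h3] at e
  linarith

/-- **At most two apices.** If `a, b, c` are pairwise at distance `2` and `p₀, p₁, p₂` are each at distance `2`
from `a`, `b` and `c`, then two of the `pᵢ` coincide. [folklore] -/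
theorem apices_le_two {a b c : EuclideanSpace ℝ (Fin 3)} (hab : dist a b = 2) (hac : dist a c = 2) (hbc : dist b c = 2)
    (p : Fin 3 → EuclideanSpace ℝ (Fin 3)) (hpa : ∀ i, dist (p i) a = 2) (hpb : ∀ i, dist (p i) b = 2)
    (hpc : ∀ i, dist (p i) c = 2) : ¬ Function.Injective p := by
  intro hinj
  -- frame at `a` (opaque names)
  obtain ⟨w1, hw1⟩ : ∃ w1 : EuclideanSpace ℝ (Fin 3), w1 = b - a := ⟨_, rfl⟩
  obtain ⟨w2, hw2⟩ : ∃ w2 : EuclideanSpace ℝ (Fin 3), w2 = c - a := ⟨_, rfl⟩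
  obtain ⟨v, hv⟩ : ∃ v : Fin 3 → EuclideanSpace ℝ (Fin 3), ∀ i, v i = p i - a := ⟨_, fun i => rfl⟩
  have hw1n' : ‖w1‖ = 2 := by rw [hw1, ← dist_eq_norm, dist_comm, hab]
  have hw2n' : ‖w2‖ = 2 := by rw [hw2, ← dist_eq_norm, dist_comm, hac]
  have hw1n : ⟪w1, w1⟫ = 4 := by rw [real_inner_self_eq_norm_sq, hw1n']; norm_num
  have hw2n : ⟪w2, w2⟫ = 4 := by rw [real_inner_self_eq_norm_sq, hw2n']; norm_num
  have hw12 : ⟪w1, w2⟫ = 2 := by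
    have : ⟪c - a, b - a⟫ = 2 :=
      inner_apex_eq_two hab (by rw [dist_comm]; exact hac) (by rw [dist_comm]; exact hbc)
    rw [hw1, hw2, real_inner_comm]; exact this
  have hvn : ∀ i, ‖v i‖ = 2 := fun i => by rw [hv, ← dist_eq_norm, hpa i]
  have hv1 : ∀ i, ⟪v i, w1⟫ = 2 := fun i => by rw [hv, hw1]; exact inner_apex_eq_two hab (hpa i) (hpb i)
  have hv2 : ∀ i, ⟪v i, w2⟫ = 2 := fun i => by rw [hv, hw2]; exact inner_apex_eq_two hac (hpa i) (hpc i)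
  -- differences are orthogonal to w1, w2
  obtain ⟨u1, hu1⟩ : ∃ u1 : EuclideanSpace ℝ (Fin 3), u1 = v 0 - v 1 := ⟨_, rfl⟩
  obtain ⟨u2, hu2⟩ : ∃ u2 : EuclideanSpace ℝ (Fin 3), u2 = v 0 - v 2 := ⟨_, rfl⟩
  have hu1w1 : ⟪u1, w1⟫ = 0 := by rw [hu1, inner_sub_left, hv1, hv1]; ring
  have hu1w2 : ⟪u1, w2⟫ = 0 := by rw [hu1, inner_sub_left, hv2, hv2]; ring
  have hu2w1 : ⟪u2, w1⟫ = 0 := by rw [hu2, inner_sub_left, hv1, hv1]; ring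
  have hu2w2 : ⟪u2, w2⟫ = 0 := by rw [hu2, inner_sub_left, hv2, hv2]; ring
  -- norm constraints: 2 ⟪v 0, u⟫ = ⟪u, u⟫ for u = u1, u2
  have hn1 : 2 * ⟪v 0, u1⟫ = ⟪u1, u1⟫ := by
    have e : v 0 - u1 = v 1 := by rw [hu1]; abel
    have h := norm_sub_sq_real (v 0) u1
    rw [e, hvn 1, hvn 0, ← real_inner_self_eq_norm_sq u1] at h
    linarith
  have hn2 : 2 * ⟪v 0, u2⟫ = ⟪u2, u2⟫ := by
    have e : v 0 - u2 = v 2 := by rw [hu2]; abel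
    have h := norm_sub_sq_real (v 0) u2
    rw [e, hvn 2, hvn 0, ← real_inner_self_eq_norm_sq u2] at h
    linarith
  -- four vectors w1, w2, u1, u2 in ℝ³ are linearly dependent
  have hdep : ¬ LinearIndependent ℝ ![w1, w2, u1, u2] := by
    intro hli
    have := hli.fintype_card_le_finrank
    rw [finrank_euclideanSpace_fin, Fintype.card_fin] at this
    omega
  rw [Fintype.not_linearIndependent_iff] at hdep
  obtain ⟨g, hg, i0, hi0⟩ := hdep
  simp only [Fin.sum_univ_four, Matrix.cons_val_zero, Matrix.cons_val_one, Matrix.cons_val] at hg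
  -- pair with w1 and w2: g0 = g1 = 0
  have e1 : ⟪g 0 • w1 + g 1 • w2 + g 2 • u1 + g 3 • u2, w1⟫ = 0 := by rw [hg, inner_zero_left]
  have e2 : ⟪g 0 • w1 + g 1 • w2 + g 2 • u1 + g 3 • u2, w2⟫ = 0 := by rw [hg, inner_zero_left]
  simp only [inner_add_left, real_inner_smul_left, hw1n, hw12, hu1w1, hu2w1, hw2n, hu1w2, hu2w2,
    real_inner_comm w1 w2] at e1 e2
  have hg0 : g 0 = 0 := by linarith
  have hg1 : g 1 = 0 := by linarith
  rw [hg0, hg1, zero_smul, zero_smul, zero_add, zero_add] at hg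
  -- so g2 • u1 + g3 • u2 = 0 with (g2, g3) ≠ 0
  have hg23 : g 2 ≠ 0 ∨ g 3 ≠ 0 := by
    fin_cases i0
    · exact absurd hg0 hi0
    · exact absurd hg1 hi0
    · exact Or.inl hi0
    · exact Or.inr hi0
  have hvinj : ∀ i j, v i = v j → p i = p j := fun i j h => by
    rw [hv, hv] at h; exact sub_left_injective h
  have h01 : p 0 ≠ p 1 := fun h => by have := hinj h; exact absurd this (by decide)
  have h02 : p 0 ≠ p 2 := fun h => by have := hinj h; exact absurd this (by decide)
  have h12 : p 1 ≠ p 2 := fun h => by have := hinj h; exact absurd this (by decide)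
  have hu1ne : u1 ≠ 0 := by
    intro h; apply h01
    have : v 0 = v 1 := sub_eq_zero.mp (by rw [← hu1]; exact h)
    exact hvinj 0 1 this
  have hu2ne : u2 ≠ 0 := by
    intro h; apply h02
    have : v 0 = v 2 := sub_eq_zero.mp (by rw [← hu2]; exact h)
    exact hvinj 0 2 this
  rcases hg23 with h2 | h3
  · -- u1 = t • u2 with t = -g3/g2
    have ht : u1 = (-(g 3) / g 2) • u2 := by
      have : g 2 • u1 = -(g 3 • u2) := eq_neg_of_add_eq_zero_left hg
      calc u1 = (g 2)⁻¹ • (g 2 • u1) := by rw [smul_smul, inv_mul_cancel₀ h2, one_smul]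
        _ = (-(g 3) / g 2) • u2 := by rw [this, smul_neg, smul_smul, div_eq_mul_inv, mul_comm]; simp [neg_smul]
    set t := -(g 3) / g 2 with htdef
    -- from hn1, hn2: t² ⟪u2,u2⟫ = t ⟪u2,u2⟫
    have hq : ⟪u2, u2⟫ ≠ 0 := by rwa [ne_eq, inner_self_eq_zero]
    have e3 : 2 * ⟪v 0, u1⟫ = t * ⟪u2, u2⟫ := by rw [ht, real_inner_smul_right, ← mul_assoc, mul_comm 2 t, mul_assoc, hn2]
    have e4 : ⟪u1, u1⟫ = t * t * ⟪u2, u2⟫ := by rw [ht, real_inner_smul_left, real_inner_smul_right]; ring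
    have e5 : t * ⟪u2, u2⟫ = t * t * ⟪u2, u2⟫ := by rw [← e3, hn1, e4]
    have ht01 : t = 0 ∨ t = 1 := by
      have : t * (t - 1) * ⟪u2, u2⟫ = 0 := by linarith
      rcases mul_eq_zero.mp this with h | h
      · rcases mul_eq_zero.mp h with h' | h'
        · exact Or.inl h'
        · exact Or.inr (by linarith)
      · exact absurd h hq
    rcases ht01 with h0 | h1
    · exact hu1ne (by rw [ht, h0, zero_smul])
    · apply h12
      have : v 1 = v 2 := by
        have e : u1 = u2 := by rw [ht, h1, one_smul]
        rw [hu1, hu2] at e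
        exact sub_right_injective e
      exact hvinj 1 2 this
  · -- symmetric: u2 = t • u1
    have ht : u2 = (-(g 2) / g 3) • u1 := by
      have : g 3 • u2 = -(g 2 • u1) := eq_neg_of_add_eq_zero_right hg
      calc u2 = (g 3)⁻¹ • (g 3 • u2) := by rw [smul_smul, inv_mul_cancel₀ h3, one_smul]
        _ = (-(g 2) / g 3) • u1 := by rw [this, smul_neg, smul_smul, div_eq_mul_inv, mul_comm]; simp [neg_smul]
    set t := -(g 2) / g 3 with htdef
    have hq : ⟪u1, u1⟫ ≠ 0 := by rwa [ne_eq, inner_self_eq_zero]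
    have e3 : 2 * ⟪v 0, u2⟫ = t * ⟪u1, u1⟫ := by rw [ht, real_inner_smul_right, ← mul_assoc, mul_comm 2 t, mul_assoc, hn1]
    have e4 : ⟪u2, u2⟫ = t * t * ⟪u1, u1⟫ := by rw [ht, real_inner_smul_left, real_inner_smul_right]; ring
    have e5 : t * ⟪u1, u1⟫ = t * t * ⟪u1, u1⟫ := by rw [← e3, hn2, e4]
    have ht01 : t = 0 ∨ t = 1 := by
      have : t * (t - 1) * ⟪u1, u1⟫ = 0 := by linarith
      rcases mul_eq_zero.mp this with h | h
      · rcases mul_eq_zero.mp h with h' | h'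
        · exact Or.inl h'
        · exact Or.inr (by linarith)
      · exact absurd h hq
    rcases ht01 with h0 | h1
    · exact hu2ne (by rw [ht, h0, zero_smul])
    · apply h12
      have : v 1 = v 2 := by
        have e : u2 = u1 := by rw [ht, h1, one_smul]
        rw [hu1, hu2] at e
        exact (sub_right_injective e).symm
      exact hvinj 1 2 this

/-! ### 4. Corollaries for the cell's unit packings (diameter `1`, contact = distance `1`) -/

section UnitPacking

variable {N : ℕ} {x : Fin N → EuclideanSpace ℝ (Fin 3)}

/-- **`pair5` (engine-1's filter) is a theorem: a contact edge has at most five common contact neighbours.**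
For a packing of unit-diameter balls and two touching balls `i, j`, at most five balls touch both.
[folklore] -/
theorem card_common_contactNeighbors_le_five (hx : IsUnitPacking x) {i j : Fin N}
    (hij : dist (x i) (x j) = 1) : (contactNeighbors x i ∩ contactNeighbors x j).card ≤ 5 := by
  classical
  by_contra h
  obtain ⟨F, hF, hcard⟩ := Finset.exists_subset_card_eq (show 6 ≤ (contactNeighbors x i ∩ contactNeighbors x j).card by omega)
  set e := (Finset.equivFinOfCardEq hcard).symm with he
  have hmem : ∀ k, ((e k : F) : Fin N) ∈ contactNeighbors x i ∩ contactNeighbors x j := fun k => hF (e k).2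
  refine no_six_common_neighbours' (a := (2 : ℝ) • x i) (c := (2 : ℝ) • x j) (by rw [dist_two_smul, hij]; norm_num)
    (fun k => (2 : ℝ) • x ((e k : F) : Fin N)) ?_ ?_ ?_ ?_
  · intro k l hkl
    have h2 : x ((e k : F) : Fin N) = x ((e l : F) : Fin N) := smul_right_injective _ (by norm_num : (2 : ℝ) ≠ 0) hkl
    exact e.injective (Subtype.val_injective (hx.injective h2))
  · intro k
    have := (mem_contactNeighbors x).1 (Finset.mem_inter.1 (hmem k)).1
    rw [dist_two_smul, dist_comm, this.2]; norm_num
  · intro k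
    have := (mem_contactNeighbors x).1 (Finset.mem_inter.1 (hmem k)).2
    rw [dist_two_smul, dist_comm, this.2]; norm_num
  · intro k l hkl
    have hne : ((e k : F) : Fin N) ≠ ((e l : F) : Fin N) := fun h' =>
      hkl (e.injective (Subtype.val_injective h'))
    rw [dist_two_smul]
    have := hx.one_le_dist hne
    linarith

/-- **`triple2` (engine-1's filter) is a theorem: a contact triangle has at most two apices.** For a packing of
unit-diameter balls and three pairwise touching balls `i, j, l`, at most two balls touch all three. [folklore] -/
theorem card_common_contactNeighbors_three_le_two (hx : IsUnitPacking x) {i j l : Fin N}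
    (hij : dist (x i) (x j) = 1) (hil : dist (x i) (x l) = 1) (hjl : dist (x j) (x l) = 1) :
    (contactNeighbors x i ∩ contactNeighbors x j ∩ contactNeighbors x l).card ≤ 2 := by
  classical
  by_contra h
  obtain ⟨F, hF, hcard⟩ := Finset.exists_subset_card_eq
    (show 3 ≤ (contactNeighbors x i ∩ contactNeighbors x j ∩ contactNeighbors x l).card by omega)
  set e := (Finset.equivFinOfCardEq hcard).symm with he
  have hmem : ∀ k, ((e k : F) : Fin N) ∈ contactNeighbors x i ∩ contactNeighbors x j ∩ contactNeighbors x l :=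
    fun k => hF (e k).2
  have hi : ∀ k, dist (x i) (x ((e k : F) : Fin N)) = 1 := fun k =>
    ((mem_contactNeighbors x).1 (Finset.mem_inter.1 (Finset.mem_inter.1 (hmem k)).1).1).2
  have hj : ∀ k, dist (x j) (x ((e k : F) : Fin N)) = 1 := fun k =>
    ((mem_contactNeighbors x).1 (Finset.mem_inter.1 (Finset.mem_inter.1 (hmem k)).1).2).2
  have hl : ∀ k, dist (x l) (x ((e k : F) : Fin N)) = 1 := fun k =>
    ((mem_contactNeighbors x).1 (Finset.mem_inter.1 (hmem k)).2).2
  refine apices_le_two (a := (2 : ℝ) • x i) (b := (2 : ℝ) • x j) (c := (2 : ℝ) • x l)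
    (by rw [dist_two_smul, hij]; norm_num) (by rw [dist_two_smul, hil]; norm_num) (by rw [dist_two_smul, hjl]; norm_num)
    (fun k => (2 : ℝ) • x ((e k : F) : Fin N)) ?_ ?_ ?_ ?_
  · intro k; rw [dist_two_smul, dist_comm, hi k]; norm_num
  · intro k; rw [dist_two_smul, dist_comm, hj k]; norm_num
  · intro k; rw [dist_two_smul, dist_comm, hl k]; norm_num
  · intro k m hkm
    have h2 : x ((e k : F) : Fin N) = x ((e m : F) : Fin N) := smul_right_injective _ (by norm_num : (2 : ℝ) ≠ 0) hkm
    exact e.injective (Subtype.val_injective (hx.injective h2))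

end UnitPacking

end Summit.Ventures.Crystal3D

end
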